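import Summits.KontsevichZagierPeriods.KontsevichZagierPeriods.Theorems.SoloBlindBoxRankOne
import HarnessLib

/-!
# The box sector of the Kontsevich–Zagier conjecture, VII: rational cells and worked examples

The standard cells with rational coefficients are *rational* integral representations in
Kontsevich–Zagier's literal sense (`IntegralRep.IsRational`: integrand `p/q` with `p, q ∈ ℚ[x]`),
so the hypotheses of the sector theorems are met by concrete integrals; and two worked instances of
the unconditional rank-one theorem (`SoloBlindBoxRankOne`):

* `(∫₁² dx/x)·(∫₁⁸ dx/x)` and `(∫₁² 3dx/x)·(∫₁² dx/x)` (both `= 3 (log 2)²`) are equivalent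
  two-dimensional representations under the Kontsevich–Zagier moves (`kz_example_log`);
* `(∫₀¹ 4dx/(1+x²))²` and `(∫₀¹ 8dx/(1+x²))·(∫₀¹ 2dx/(1+x²))` (both `= π²`) are equivalent
  (`kz_example_pi`).

References: M. Kontsevich, D. Zagier, *Periods* (2001), §1.1–1.2.
-/

noncomputable section

open scoped BigOperators

namespace Summit.KontsevichZagierPeriods.KontsevichZagierPeriods.Theorems

open Set MeasureTheory
open Literature.NumberTheory.Transcendental
open Literature.NumberTheory.Transcendental.KZ

namespace SoloBlind

/-! ## Rational cells -/

/-- The point cell `[pt, q]` with `q ∈ ℚ` is rational. -/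
theorem isRational_constCell (q : ℚ) : (constCell (q : ℝ) (isAlgebraic_rat ℚ q)).IsRational :=
  ⟨MvPolynomial.C q, 1, fun x _ => by simp, fun x _ => by
    simp only [constCell_integrand, MvPolynomial.aeval_C, map_one, div_one, eq_ratCast]⟩

/-- The logarithmic segment `L(q; a, b) = ∫_a^b q dx/x` (`q ∈ ℚ`, `0 < a`) is rational. -/
theorem isRational_logSeg (q : ℚ) {a b : ℝ} (ha : IsAlgebraic ℚ a) (hb : IsAlgebraic ℚ b)
    (h0 : 0 < a) : (logSeg (q : ℝ) a b (isAlgebraic_rat ℚ q) ha hb h0).IsRational := by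
  refine ⟨MvPolynomial.C q, MvPolynomial.X 0, fun x hx => ?_, fun x _ => ?_⟩
  · rw [logSeg_domain, mem_line] at hx
    rw [MvPolynomial.aeval_X]
    exact (h0.trans_le hx.1).ne'
  · simp only [logSeg_integrand, MvPolynomial.aeval_C, MvPolynomial.aeval_X, eq_ratCast]

/-- The logarithmic cell `L(q; μ) = ∫₁^μ q dx/x` (`q ∈ ℚ`) is rational. -/
theorem isRational_logCell (q : ℚ) {μ : ℝ} (hμ : IsAlgebraic ℚ μ) :
    (logCell (q : ℝ) μ (isAlgebraic_rat ℚ q) hμ).IsRational :=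
  isRational_logSeg q isAlgebraic_one hμ one_pos

/-- The arctangent segment `A(q; a, b) = ∫_a^b q dx/(1+x²)` (`q ∈ ℚ`) is rational. -/
theorem isRational_atanSeg (q : ℚ) {a b : ℝ} (ha : IsAlgebraic ℚ a) (hb : IsAlgebraic ℚ b) :
    (atanSeg (q : ℝ) a b (isAlgebraic_rat ℚ q) ha hb).IsRational := by
  refine ⟨MvPolynomial.C q, 1 + MvPolynomial.X 0 ^ 2, fun x _ => ?_, fun x _ => ?_⟩
  · rw [map_add, map_one, map_pow, MvPolynomial.aeval_X]
    positivity
  · simp only [atanSeg_integrand, MvPolynomial.aeval_C, map_add, map_one, map_pow,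
      MvPolynomial.aeval_X, eq_ratCast]

/-- The arctangent cell `A(q; t) = ∫₀^t q dx/(1+x²)` (`q ∈ ℚ`) is rational. -/
theorem isRational_atanCell (q : ℚ) {t : ℝ} (ht : IsAlgebraic ℚ t) :
    (atanCell (q : ℝ) t (isAlgebraic_rat ℚ q) ht).IsRational :=
  isRational_atanSeg q isAlgebraic_zero ht

/-! ## Membership of the rational cells in the rank-one rings -/

/-- `L(q; μᵏ) ∈ B(log μ)` for `q ∈ ℚ`, `μ ≥ 1` algebraic: its value is `q k · log μ`. -/
theorem logCell_pow_mem_lineRing (q : ℚ) {μ : ℝ} (hμ : IsAlgebraic ℚ μ) (h1 : 1 ≤ μ) (k : ℕ) :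
    of (logCell (q : ℝ) (μ ^ k) (isAlgebraic_rat ℚ q) (hμ.pow k)) ∈ lineRing (Real.log μ) :=
  of_mem_lineRing _ le_rfl (isRational_logCell q (hμ.pow k)) isAlgebraic_zero
    (isAlgebraic_rat ℚ (q * k)) (by
      rw [value_logCell (one_le_pow₀ h1), Real.log_pow]
      push_cast
      ring)

/-- `A(q; 1) ∈ B(π)` for `q ∈ ℚ`: its value is `q · π/4`. -/
theorem atanCell_one_mem_lineRing (q : ℚ) :
    of (atanCell (q : ℝ) 1 (isAlgebraic_rat ℚ q) isAlgebraic_one) ∈ lineRing Real.pi :=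
  of_mem_lineRing _ le_rfl (isRational_atanCell q isAlgebraic_one) isAlgebraic_zero
    (isAlgebraic_rat ℚ (q / 4)) (by
      rw [value_atanCell zero_le_one, Real.arctan_one]
      push_cast
      ring)

/-! ## Worked examples -/

/-- **Example (logarithms).**  `(∫₁² dx/x)·(∫₁⁸ dx/x) = 3 (log 2)² = (∫₁² 3dx/x)·(∫₁² dx/x)`, and
the two product representations are equivalent under the Kontsevich–Zagier moves —
unconditionally. -/
theorem kz_example_log :
    Equivalent
      ((logCell ((1 : ℚ) : ℝ) ((2 : ℝ) ^ 1) (isAlgebraic_rat ℚ 1) ((isAlgebraic_nat 2).pow 1)).prod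
        (logCell ((1 : ℚ) : ℝ) ((2 : ℝ) ^ 3) (isAlgebraic_rat ℚ 1) ((isAlgebraic_nat 2).pow 3)))
      ((logCell ((3 : ℚ) : ℝ) ((2 : ℝ) ^ 1) (isAlgebraic_rat ℚ 3) ((isAlgebraic_nat 2).pow 1)).prod
        (logCell ((1 : ℚ) : ℝ) ((2 : ℝ) ^ 1) (isAlgebraic_rat ℚ 1) ((isAlgebraic_nat 2).pow 1))) := by
  have h2 : IsAlgebraic ℚ (2 : ℝ) := isAlgebraic_nat 2
  refine kz_lineRing_log h2 one_lt_two _ _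
    (mul_mem_lineRing (logCell_pow_mem_lineRing 1 h2 one_le_two 1)
      (logCell_pow_mem_lineRing 1 h2 one_le_two 3))
    (mul_mem_lineRing (logCell_pow_mem_lineRing 3 h2 one_le_two 1)
      (logCell_pow_mem_lineRing 1 h2 one_le_two 1)) ?_
  rw [IntegralRep.value_prod, IntegralRep.value_prod,
    value_logCell (one_le_pow₀ one_le_two), value_logCell (one_le_pow₀ one_le_two),
    value_logCell (one_le_pow₀ one_le_two), Real.log_pow, Real.log_pow]
  push_cast
  ring

/-- **Example (`π`).**  `(∫₀¹ 4dx/(1+x²))² = π² = (∫₀¹ 8dx/(1+x²))·(∫₀¹ 2dx/(1+x²))`, and the two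
product representations are equivalent under the Kontsevich–Zagier moves — unconditionally. -/
theorem kz_example_pi :
    Equivalent
      ((atanCell ((4 : ℚ) : ℝ) 1 (isAlgebraic_rat ℚ 4) isAlgebraic_one).prod
        (atanCell ((4 : ℚ) : ℝ) 1 (isAlgebraic_rat ℚ 4) isAlgebraic_one))
      ((atanCell ((8 : ℚ) : ℝ) 1 (isAlgebraic_rat ℚ 8) isAlgebraic_one).prod
        (atanCell ((2 : ℚ) : ℝ) 1 (isAlgebraic_rat ℚ 2) isAlgebraic_one)) := by
  refine kz_lineRing_pi _ _
    (mul_mem_lineRing (atanCell_one_mem_lineRing 4) (atanCell_one_mem_lineRing 4))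
    (mul_mem_lineRing (atanCell_one_mem_lineRing 8) (atanCell_one_mem_lineRing 2)) ?_
  rw [IntegralRep.value_prod, IntegralRep.value_prod, value_atanCell zero_le_one,
    value_atanCell zero_le_one, value_atanCell zero_le_one]
  push_cast
  ring

end SoloBlind

end Summit.KontsevichZagierPeriods.KontsevichZagierPeriods.Theorems
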